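import Literature.NumberTheory.LFunctions.NicolasCLimsupRH
import Literature.NumberTheory.LFunctions.FordZetaZeroRecipSqSum
import Literature.NumberTheory.LFunctions.SchoenfeldThetaLarge
import HarnessLib

/-!
# RH-CONDITIONAL — Nicolas 2012, Prop. 2.1 (2.16)–(2.17) (left/right halves) and Prop. 3.1 (3.2) with the printed constants: under RH, `c(N_k) ≤ e^γ(2+β) − 0.07/log x` for `x ≥ 10⁹`; nothing here bears on the truth of RH

RH-CONDITIONAL (explicit inequalities under the hypothesis `RiemannHypothesis`; read contrapositively
they are one-sided, checkable criteria: a primorial `N_k` with `p_k ≥ 10⁹` and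
`c(N_k) > e^γ(2+β) − 0.07/log p_k` would refute RH); nothing here bears on the truth of RH.
Literature-typing tranche 1 (Broughan, *Equivalents of the Riemann Hypothesis* vol. 1, §5.7), from
the primary source J.-L. Nicolas, Acta Arith. 155 (2012), 311–321, §§2–3. The tree holds Prop. 3.1 in
asymptotic form (`NicolasCLimsupRH.lean`, §§3–4: for every `ε > 0`, eventually
`c(⌊x⌋#) ≤ e^γ(2+β) + ε`) and its lower half explicitly at Schoenfeld's threshold `599²` (§9 there);
this file proves the **upper half with Nicolas's printed constants at his threshold `x₀ = 10⁹`**,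
following the printed proof line by line:

* (2.20)/(2.16, left) `log f(x) ≥ −(2+β)/(√x log x) + 0.055/(√x log² x)` for `x ≥ 10⁹`
  (`logf_ge_explicit_of`: the tree's (2.18) = `Nicolas2012_logf_lower_sharp` — a PROVED named fact,
  `Nicolas2012_logf_lower_sharp_holds` — and the monotonicity of its four lower-order terms from
  `x₀` on, `log_pow_div_rpow_le`; the printed (2.16) has `W(x)` where we write its bound `β`, (1.19));
* (2.17, right) `1/f(x) − 1 ≤ (2+β)/(√x log x) − 0.054/(√x log² x)` (`inv_nicolasF_sub_one_le_of`:
  `e^v − 1 ≤ v + v²`);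
* (3.4) and "`|√θ(x) log θ(x)/(√x log x) − 1| ≤ 0.0069/log x`" (upper side, `ratio_le_of`, from
  Schoenfeld's `|θ(x) − x| ≤ √x log² x/(8π)`, the named fact `Schoenfeld1976_theta`, PROVED in the tree);
* **(3.2)** `c(N_k) ≤ e^γ(2+β) − 0.07/log x` for `10⁹ ≤ p_k ≤ x < p_{k+1}`
  (`Nicolas2012_prop3_1_upper_of`, over the two named facts as hypotheses — standard axioms — and
  `Nicolas2012_prop3_1_upper`, fed with their proofs, whose certified zeta-zero numerics make it
  computational in the gate's census), and the form used in §4 of the paper for (1.5)–(1.6):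
  `c(p#) < e^γ(2+β)` for every prime `p ≥ 10⁹` (`nicolasC_primorial_lt_nicolasCLimsup_of_ge`).

## References

* J.-L. Nicolas, *Small values of the Euler function and the Riemann hypothesis*, Acta Arith. 155
  (2012), 311–321: Prop. 2.1 (2.16)–(2.17), (2.18), (2.20); Prop. 3.1 (3.2), (3.4); §4. [Nicolas2012]
* L. Schoenfeld, *Sharper bounds for the Chebyshev functions θ(x) and ψ(x). II*, Math. Comp. 30
  (1976), 337–360, (6.3). [Schoenfeld1976]
* K. Broughan, *Equivalents of the Riemann Hypothesis*, vol. 1, CUP 2017, §5.7. [Broughan2017]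
-/

noncomputable section

open Real
open scoped Chebyshev

namespace Literature.NumberTheory.LFunctions

namespace NicolasCUpper

/-! ### Numerical constants -/

/-- `e^γ < 1.7810726`. [folklore] -/
private theorem exp_gamma_lt : rexp eulerMascheroniConstant < 1.7810726 := by
  have hγ := Literature.Analysis.SpecialFunctions.Real.eulerMascheroniConstant_lt_d8
  have h1 : rexp eulerMascheroniConstant < rexp 0.57721571 := Real.exp_lt_exp.2 hγ
  have h2 := Real.exp_bound' (x := (0.57721571 : ℝ)) (by norm_num) (by norm_num) (n := 10)
    (by norm_num)
  have h3 : (∑ m ∈ Finset.range 10, (0.57721571 : ℝ) ^ m / m.factorial) +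
      (0.57721571 : ℝ) ^ 10 * (10 + 1) / (Nat.factorial 10 * 10) < 1.7810726 := by
    norm_num [Finset.sum_range_succ, Nat.factorial]
  push_cast at h2
  linarith

/-- `1.78107 ≤ e^γ` (eight terms of the exponential series at `0.57721558 < γ`). [folklore] -/
private theorem exp_gamma_gt : (1.78107 : ℝ) ≤ rexp eulerMascheroniConstant := by
  have hγ := Literature.Analysis.SpecialFunctions.Real.eulerMascheroniConstant_gt_d8
  have h1 : rexp 0.57721558 ≤ rexp eulerMascheroniConstant := Real.exp_le_exp.2 hγ.le
  have h2 := Real.sum_le_exp_of_nonneg (x := (0.57721558 : ℝ)) (by norm_num) 8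
  have h3 : (1.78107 : ℝ) ≤ ∑ i ∈ Finset.range 8, (0.57721558 : ℝ) ^ i / (i.factorial : ℝ) := by
    norm_num [Finset.sum_range_succ, Nat.factorial]
  linarith

/-- `0.045 < β < 0.046192`. [folklore] -/
private theorem beta_bounds : (0.045 : ℝ) < nicolasBeta ∧ nicolasBeta < 0.046192 :=
  ⟨nicolasBeta_gt, FordL33.nicolasBeta_lt_d5⟩

/-- `3.6 ≤ e^γ(2+β) = nicolasCLimsup`. [folklore] -/
private theorem nicolasCLimsup_ge : (3.6 : ℝ) ≤ nicolasCLimsup := by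
  have h1 := exp_gamma_gt
  have h2 := beta_bounds.1
  unfold nicolasCLimsup
  nlinarith

/-! ### The anchor `x₀ = 10⁹` -/

/-- `20.7232658 ≤ log 10⁹ ≤ 20.72326585`. [folklore] -/
private theorem log_x0_bounds :
    (20.7232658 : ℝ) ≤ Real.log ((10 : ℝ) ^ 9) ∧ Real.log ((10 : ℝ) ^ 9) ≤ 20.72326585 := by
  rw [Real.log_pow, show (10 : ℝ) = 2 * 5 by norm_num, Real.log_mul (by norm_num) (by norm_num)]
  have := Real.log_two_lt_d9; have := Real.log_five_lt_d9
  have := Real.log_two_gt_d9; have := Real.log_five_gt_d9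
  push_cast
  constructor <;> linarith

/-- `31622.776 ≤ √(10⁹)`. [folklore] -/
private theorem sqrt_x0_ge : (31622.776 : ℝ) ≤ Real.sqrt ((10 : ℝ) ^ 9) := by
  rw [Real.le_sqrt' (by norm_num : (0 : ℝ) < 31622.776)]; norm_num

/-! ### (2.20): the explicit lower bound for `log f` -/

/-- **Nicolas 2012, (2.20) ⟹ (2.16) (left half, `W` replaced by its bound `β`)**: under RH, for
`x ≥ 10⁹`, `log f(x) ≥ −(2+β)/(√x log x) + 0.055/(√x log² x)`; from (2.18) (the named fact
`Nicolas2012_logf_lower_sharp`, a hypothesis here) by bounding its lower-order terms at `x₀ = 10⁹`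
("Since `x ≥ x₀ = 10⁹` holds, (2.18) implies (2.20)": each of `(8+4β)/log x`, `log(2π) log x/√x`,
`2 log x/x^{1/6}`, `log⁵x/(64π²√x)` is non-increasing from `x₀` on, and
`2 − β − 0.39496 − 0.00137 − 1.31066 − 0.19135 ≥ 0.055`).
[cite: Nicolas2012, Prop. 2.1 (2.16) with (2.18), (2.20)] -/
theorem logf_ge_explicit_of (h18 : Nicolas2012_logf_lower_sharp) (hRH : RiemannHypothesis) {x : ℝ}
    (hx : (10 : ℝ) ^ 9 ≤ x) :
    -(2 + nicolasBeta) / (Real.sqrt x * Real.log x) + 0.055 / (Real.sqrt x * Real.log x ^ 2) ≤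
      Real.log (nicolasF x) := by
  have hx0 : 0 < x := lt_of_lt_of_le (by norm_num) hx
  have hmain := h18 hRH x (le_trans (by norm_num) hx)
  set L := Real.log x with hL
  set y := x ^ ((1 : ℝ) / 6) with hy
  have hy0 : 0 < y := Real.rpow_pos_of_pos hx0 _
  have hy3 : y ^ 3 = x ^ ((1 : ℝ) / 2) := by
    rw [hy, ← Real.rpow_mul_natCast hx0.le]; norm_num
  have hy4 : y ^ 4 = x ^ ((2 : ℝ) / 3) := by
    rw [hy, ← Real.rpow_mul_natCast hx0.le]; norm_num
  have hy6 : y ^ 6 = x := by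
    rw [hy, ← Real.rpow_mul_natCast hx0.le]; norm_num
  have hsqrt : √x = y ^ 3 := by rw [hy3, Real.sqrt_eq_rpow]
  -- the anchor
  have hx9 : (0 : ℝ) < 10 ^ 9 := by norm_num
  obtain ⟨hlog9l, hlog9u⟩ := log_x0_bounds
  have hL0 : (20.7232658 : ℝ) ≤ L := hlog9l.trans (Real.log_le_log hx9 hx)
  have hLpos : 0 < L := by linarith
  have hs9 : (31622.776 : ℝ) ≤ ((10 : ℝ) ^ 9) ^ ((1 : ℝ) / 2) := by
    rw [← Real.sqrt_eq_rpow]; exact sqrt_x0_ge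
  have hy9 : (31.62277 : ℝ) ≤ ((10 : ℝ) ^ 9) ^ ((1 : ℝ) / 6) := by
    by_contra hlt
    push Not at hlt
    have h6 := pow_lt_pow_left₀ hlt (Real.rpow_nonneg hx9.le _) (by norm_num : (6 : ℕ) ≠ 0)
    rw [← Real.rpow_mul_natCast hx9.le] at h6
    norm_num at h6
  -- the three antitone second-order terms, bounded at the anchor
  have hA2 : L / y ^ 3 ≤ 0.00065533 := by
    have h1 := log_pow_div_rpow_le (a := 1 / 2) (by norm_num) (k := 1) le_rfl hx9
      (le_trans (by norm_num) hlog9l) hx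
    rw [pow_one, pow_one] at h1
    rw [hy3]
    calc L / x ^ ((1 : ℝ) / 2) ≤ Real.log ((10 : ℝ) ^ 9) / ((10 : ℝ) ^ 9) ^ ((1 : ℝ) / 2) := h1
      _ ≤ 20.72326585 / ((10 : ℝ) ^ 9) ^ ((1 : ℝ) / 2) :=
          div_le_div_of_nonneg_right hlog9u (by positivity)
      _ ≤ 20.72326585 / 31622.776 := div_le_div_of_nonneg_left (by norm_num) (by norm_num) hs9
      _ ≤ 0.00065533 := by norm_num
  have hA3 : L / y ≤ 0.655328 := by
    have h1 := log_pow_div_rpow_le (a := 1 / 6) (by norm_num) (k := 1) le_rfl hx9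
      (le_trans (by norm_num) hlog9l) hx
    rw [pow_one, pow_one] at h1
    rw [hy]
    calc L / x ^ ((1 : ℝ) / 6) ≤ Real.log ((10 : ℝ) ^ 9) / ((10 : ℝ) ^ 9) ^ ((1 : ℝ) / 6) := h1
      _ ≤ 20.72326585 / ((10 : ℝ) ^ 9) ^ ((1 : ℝ) / 6) :=
          div_le_div_of_nonneg_right hlog9u (by positivity)
      _ ≤ 20.72326585 / 31.62277 := div_le_div_of_nonneg_left (by norm_num) (by norm_num) hy9
      _ ≤ 0.655328 := by norm_num
  have hA5 : L ^ 5 / y ^ 3 ≤ 120.863 := by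
    have h1 := log_pow_div_rpow_le (a := 1 / 2) (by norm_num) (k := 5) (by norm_num) hx9
      (le_trans (by norm_num) hlog9l) hx
    rw [hy3]
    have h0 : 0 ≤ Real.log ((10 : ℝ) ^ 9) := le_trans (by norm_num) hlog9l
    have hl5 : Real.log ((10 : ℝ) ^ 9) ^ 5 ≤ 20.72326585 ^ 5 := pow_le_pow_left₀ h0 hlog9u 5
    calc L ^ 5 / x ^ ((1 : ℝ) / 2) ≤ Real.log ((10 : ℝ) ^ 9) ^ 5 / ((10 : ℝ) ^ 9) ^ ((1 : ℝ) / 2) := h1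
      _ ≤ 20.72326585 ^ 5 / ((10 : ℝ) ^ 9) ^ ((1 : ℝ) / 2) :=
          div_le_div_of_nonneg_right hl5 (by positivity)
      _ ≤ 20.72326585 ^ 5 / 31622.776 := div_le_div_of_nonneg_left (by norm_num) (by norm_num) hs9
      _ ≤ 120.863 := by norm_num
  -- constants
  obtain ⟨hβ0, hβ⟩ := beta_bounds
  have hlog2pi : Real.log (2 * π) ≤ 2.08 := by
    have : Real.log (2 * π) ≤ Real.log 8 := Real.log_le_log (by positivity) (by linarith [Real.pi_lt_four])
    rw [show (8 : ℝ) = 2 ^ 3 by norm_num, Real.log_pow] at this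
    have := Real.log_two_lt_d9
    push_cast at *
    linarith
  have hlog2pi0 : 0 ≤ Real.log (2 * π) := Real.log_nonneg (by linarith [Real.pi_gt_three])
  have hpi2 : (9.8696 : ℝ) ≤ π ^ 2 := by nlinarith [Real.pi_gt_d6, Real.pi_pos]
  have hT1 : (8 + 4 * nicolasBeta) / L ≤ (8 + 4 * 0.046192) / 20.7232658 := by
    calc (8 + 4 * nicolasBeta) / L ≤ (8 + 4 * 0.046192) / L :=
          div_le_div_of_nonneg_right (by linarith) hLpos.le
      _ ≤ (8 + 4 * 0.046192) / 20.7232658 := div_le_div_of_nonneg_left (by norm_num) (by norm_num) hL0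
  have hT2 : Real.log (2 * π) * (L / y ^ 3) ≤ 2.08 * 0.00065533 :=
    mul_le_mul hlog2pi hA2 (by positivity) (by norm_num)
  have hT4 : L ^ 5 / y ^ 3 / (64 * π ^ 2) ≤ 120.863 / (64 * 9.8696) := by
    calc L ^ 5 / y ^ 3 / (64 * π ^ 2) ≤ 120.863 / (64 * π ^ 2) :=
          div_le_div_of_nonneg_right hA5 (by positivity)
      _ ≤ 120.863 / (64 * 9.8696) := div_le_div_of_nonneg_left (by norm_num) (by norm_num) (by linarith)
  have key : 0.055 ≤ (2 - nicolasBeta) - (8 + 4 * nicolasBeta) / L - Real.log (2 * π) * (L / y ^ 3)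
      - 2 * (L / y) - L ^ 5 / y ^ 3 / (64 * π ^ 2) := by
    norm_num at hT1 hT2 hT4 ⊢
    linarith
  -- back to the divided form
  have hR : 0.055 / (y ^ 3 * L ^ 2) ≤ (2 - nicolasBeta) / (y ^ 3 * L ^ 2) - (8 + 4 * nicolasBeta) / (y ^ 3 * L ^ 3)
      - Real.log (2 * π) / (x * L) - 2 / (y ^ 4 * L) - L ^ 3 / (64 * π ^ 2 * x) := by
    rw [← hy6]
    have hπ : (0 : ℝ) < π := Real.pi_pos
    have e : (2 - nicolasBeta) / (y ^ 3 * L ^ 2) - (8 + 4 * nicolasBeta) / (y ^ 3 * L ^ 3)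
        - Real.log (2 * π) / (y ^ 6 * L) - 2 / (y ^ 4 * L) - L ^ 3 / (64 * π ^ 2 * y ^ 6) =
        ((2 - nicolasBeta) - (8 + 4 * nicolasBeta) / L - Real.log (2 * π) * (L / y ^ 3)
          - 2 * (L / y) - L ^ 5 / y ^ 3 / (64 * π ^ 2)) / (y ^ 3 * L ^ 2) := by
      field_simp
    rw [e]
    exact div_le_div_of_nonneg_right key (by positivity)
  rw [hsqrt, ← hy4] at hmain
  rw [hsqrt]
  have e1 : -(2 + nicolasBeta) / (y ^ 3 * L) = -(nicolasBeta + 2) / (y ^ 3 * L) := by ring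
  rw [e1]
  linarith

/-! ### (2.17), right half -/

/-- **Nicolas 2012, (2.17) (right half, `W` replaced by `β`)**: under RH, for `x ≥ 10⁹`,
`1/f(x) − 1 ≤ (2+β)/(√x log x) − 0.054/(√x log² x)` (`1/f − 1 = e^v − 1 ≤ v + v²`, `v = −log f`,
`v² ≤ (2+β)²/(x log² x) ≤ 0.00014/(√x log² x)`). [cite: Nicolas2012, Prop. 2.1 (2.17)] -/
theorem inv_nicolasF_sub_one_le_of (h18 : Nicolas2012_logf_lower_sharp) (hRH : RiemannHypothesis)
    {x : ℝ} (hx : (10 : ℝ) ^ 9 ≤ x) :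
    1 / nicolasF x - 1 ≤
      (2 + nicolasBeta) / (Real.sqrt x * Real.log x) - 0.054 / (Real.sqrt x * Real.log x ^ 2) := by
  have hx0 : 0 < x := lt_of_lt_of_le (by norm_num) hx
  have hx3 : (3 : ℝ) ≤ x := le_trans (by norm_num) hx
  have hf := nicolasF_pos hx3
  obtain ⟨hlog9l, -⟩ := log_x0_bounds
  have hL0 : (20.7232658 : ℝ) ≤ Real.log x := hlog9l.trans (Real.log_le_log (by norm_num) hx)
  have hs0 : (31622.776 : ℝ) ≤ Real.sqrt x := sqrt_x0_ge.trans (Real.sqrt_le_sqrt hx)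
  set L := Real.log x with hL
  set s := Real.sqrt x with hs
  have hLpos : 0 < L := by linarith
  have hspos : 0 < s := by linarith
  obtain ⟨hβ0, hβ⟩ := beta_bounds
  -- `v = −log f ≤ V`
  set V : ℝ := (2 + nicolasBeta) / (s * L) - 0.055 / (s * L ^ 2) with hV
  have hv : -Real.log (nicolasF x) ≤ V := by
    have := logf_ge_explicit_of h18 hRH hx
    rw [hV]; rw [← hs, ← hL, neg_div] at this; linarith
  -- `0 ≤ V ≤ 1`
  have hV' : V = ((2 + nicolasBeta) - 0.055 / L) / (s * L) := by
    rw [hV]; field_simp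
  have hVnum0 : 0 < (2 + nicolasBeta) - 0.055 / L := by
    have : 0.055 / L ≤ 0.055 / 20.7232658 := div_le_div_of_nonneg_left (by norm_num) (by norm_num) hL0
    norm_num at this; linarith
  have hV0 : 0 ≤ V := by rw [hV']; positivity
  have hVle : V ≤ (2 + nicolasBeta) / (s * L) := by
    rw [hV]
    have : 0 ≤ 0.055 / (s * L ^ 2) := by positivity
    linarith
  have hmain_le : (2 + nicolasBeta) / (s * L) ≤ 2.046192 / (31622.776 * 20.7232658) := by
    calc (2 + nicolasBeta) / (s * L) ≤ 2.046192 / (s * L) :=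
          div_le_div_of_nonneg_right (by linarith) (by positivity)
      _ ≤ 2.046192 / (31622.776 * 20.7232658) :=
          div_le_div_of_nonneg_left (by norm_num) (by norm_num)
            (mul_le_mul hs0 hL0 (by norm_num) hspos.le)
  have hV1 : V ≤ 1 := hVle.trans (hmain_le.trans (by norm_num))
  -- `1/f − 1 = e^v − 1 ≤ e^V − 1 ≤ V + V²`
  have h1 : 1 / nicolasF x - 1 = rexp (-Real.log (nicolasF x)) - 1 := by
    rw [Real.exp_neg, Real.exp_log hf, one_div]
  have h2 : rexp (-Real.log (nicolasF x)) ≤ rexp V := Real.exp_le_exp.2 hv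
  have h3 : rexp V - 1 ≤ V + V ^ 2 := by
    have := (abs_le.1 (Real.abs_exp_sub_one_sub_id_le (show |V| ≤ 1 by rw [abs_of_nonneg hV0]; exact hV1))).2
    linarith
  -- `V² ≤ (2+β)²/(s² L²) ≤ 0.00014/(s L²)`
  have h4 : V ^ 2 ≤ 0.00014 / (s * L ^ 2) := by
    have hsq : V ^ 2 ≤ ((2 + nicolasBeta) / (s * L)) ^ 2 := pow_le_pow_left₀ hV0 hVle 2
    have e : ((2 + nicolasBeta) / (s * L)) ^ 2 = ((2 + nicolasBeta) ^ 2 / s) / (s * L ^ 2) := by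
      field_simp
    rw [e] at hsq
    refine hsq.trans (div_le_div_of_nonneg_right ?_ (by positivity))
    rw [div_le_iff₀ hspos]
    have hb2 : (2 + nicolasBeta) ^ 2 ≤ 2.046192 ^ 2 := pow_le_pow_left₀ (by linarith) (by linarith) 2
    nlinarith
  have e5 : V + 0.00014 / (s * L ^ 2) =
      (2 + nicolasBeta) / (s * L) - 0.054 / (s * L ^ 2) - 0.00086 / (s * L ^ 2) := by
    rw [hV]; ring
  have h6 : 0 ≤ 0.00086 / (s * L ^ 2) := by positivity
  rw [h1]
  linarith

/-! ### (3.4): `√θ(x) log θ(x) ≤ (1 + 0.0069/log x) √x log x` for `x ≥ 10⁹` -/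

/-- `ratio x = √(θ/x)·(1 + log(θ/x)/log x)` (`x ≥ 3`). [folklore] -/
private theorem ratio_eq' {x : ℝ} (hx : 3 ≤ x) :
    NicolasLimsup.ratio x = Real.sqrt (θ x / x) * (1 + Real.log (θ x / x) / Real.log x) := by
  have hx0 : 0 < x := by linarith
  have hθ1 := one_lt_theta hx
  have hlx : Real.log x ≠ 0 := (Real.log_pos (by linarith)).ne'
  rw [NicolasLimsup.ratio, Real.sqrt_div (Chebyshev.theta_nonneg x), Real.log_div (by linarith) hx0.ne']
  field_simp
  ring

/-- **Nicolas 2012, proof of Prop. 3.1 ("`≤ 0.0069/log x`"), upper side**: under RH with Schoenfeld's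
bound (the named fact `Schoenfeld1976_theta`, a hypothesis here), for `x ≥ 10⁹`,
`√θ(x) log θ(x)/(√x log x) ≤ 1 + 0.0069/log x` (with `u = θ/x − 1`, `|u| ≤ δ = log² x/(8π√x)`:
`√(1+u) ≤ 1 + δ/2`, `log(1+u) ≤ δ`, and `δ (log x/2 + 1) ≤ log³x₀/(16π√x₀) + log²x₀/(8π√x₀) ≤ 0.0062`
by monotonicity from `x₀` on). [cite: Nicolas2012, Prop. 3.1 (proof, (3.4) and the display after it)] -/
theorem ratio_le_of (hS : Schoenfeld1976_theta) (hRH : RiemannHypothesis) {x : ℝ}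
    (hx : (10 : ℝ) ^ 9 ≤ x) : NicolasLimsup.ratio x ≤ 1 + 0.0069 / Real.log x := by
  have hx0 : 0 < x := lt_of_lt_of_le (by norm_num) hx
  have hx3 : (3 : ℝ) ≤ x := le_trans (by norm_num) hx
  have hx9 : (0 : ℝ) < 10 ^ 9 := by norm_num
  obtain ⟨hlog9l, hlog9u⟩ := log_x0_bounds
  have hL0 : (20.7232658 : ℝ) ≤ Real.log x := hlog9l.trans (Real.log_le_log (by norm_num) hx)
  set L := Real.log x with hL
  set s := Real.sqrt x with hs
  have hLpos : 0 < L := by linarith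
  have hspos : 0 < s := Real.sqrt_pos.2 hx0
  have hxs : s * s = x := Real.mul_self_sqrt hx0.le
  have hSx := abs_le.1 (hS hRH x (by linarith))
  -- `δ = log² x/(8π√x)` and the two antitone quantities `L²/√x`, `L³/√x`
  have hs9 : (31622.776 : ℝ) ≤ ((10 : ℝ) ^ 9) ^ ((1 : ℝ) / 2) := by
    rw [← Real.sqrt_eq_rpow]; exact sqrt_x0_ge
  have h0l : 0 ≤ Real.log ((10 : ℝ) ^ 9) := le_trans (by norm_num) hlog9l
  have hB2 : L ^ 2 / s ≤ 0.013581 := by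
    have h1 := log_pow_div_rpow_le (a := 1 / 2) (by norm_num) (k := 2) (by norm_num) hx9
      (le_trans (by norm_num) hlog9l) hx
    rw [← Real.sqrt_eq_rpow, ← Real.sqrt_eq_rpow] at h1
    have hl2 : Real.log ((10 : ℝ) ^ 9) ^ 2 ≤ 20.72326585 ^ 2 := pow_le_pow_left₀ h0l hlog9u 2
    calc L ^ 2 / s ≤ Real.log ((10 : ℝ) ^ 9) ^ 2 / Real.sqrt ((10 : ℝ) ^ 9) := h1
      _ ≤ 20.72326585 ^ 2 / Real.sqrt ((10 : ℝ) ^ 9) := div_le_div_of_nonneg_right hl2 (by positivity)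
      _ ≤ 20.72326585 ^ 2 / 31622.776 :=
          div_le_div_of_nonneg_left (by norm_num) (by norm_num) sqrt_x0_ge
      _ ≤ 0.013581 := by norm_num
  have hB3 : L ^ 3 / s ≤ 0.281433 := by
    have h1 := log_pow_div_rpow_le (a := 1 / 2) (by norm_num) (k := 3) (by norm_num) hx9
      (le_trans (by norm_num) hlog9l) hx
    rw [← Real.sqrt_eq_rpow, ← Real.sqrt_eq_rpow] at h1
    have hl3 : Real.log ((10 : ℝ) ^ 9) ^ 3 ≤ 20.72326585 ^ 3 := pow_le_pow_left₀ h0l hlog9u 3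
    calc L ^ 3 / s ≤ Real.log ((10 : ℝ) ^ 9) ^ 3 / Real.sqrt ((10 : ℝ) ^ 9) := h1
      _ ≤ 20.72326585 ^ 3 / Real.sqrt ((10 : ℝ) ^ 9) := div_le_div_of_nonneg_right hl3 (by positivity)
      _ ≤ 20.72326585 ^ 3 / 31622.776 :=
          div_le_div_of_nonneg_left (by norm_num) (by norm_num) sqrt_x0_ge
      _ ≤ 0.281433 := by norm_num
  set δ : ℝ := L ^ 2 / (8 * π * s) with hδ
  have hπ := Real.pi_gt_d6
  have hδ0 : 0 ≤ δ := by positivity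
  have hδB : δ ≤ 0.00055 := by
    have e : δ = (L ^ 2 / s) / (8 * π) := by rw [hδ]; field_simp
    rw [e, div_le_iff₀ (by positivity)]
    nlinarith
  -- `κ = δ (L/2 + 1) ≤ 0.0062`
  have hκ : δ * (L / 2 + 1) ≤ 0.0062 := by
    have e : δ * (L / 2 + 1) = (L ^ 3 / s) / (16 * π) + (L ^ 2 / s) / (8 * π) := by
      rw [hδ]; field_simp; ring
    rw [e]
    have h1 : (L ^ 3 / s) / (16 * π) ≤ 0.281433 / (16 * 3.141592) := by
      calc (L ^ 3 / s) / (16 * π) ≤ 0.281433 / (16 * π) := div_le_div_of_nonneg_right hB3 (by positivity)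
        _ ≤ 0.281433 / (16 * 3.141592) := div_le_div_of_nonneg_left (by norm_num) (by norm_num) (by linarith)
    have h2 : (L ^ 2 / s) / (8 * π) ≤ 0.013581 / (8 * 3.141592) := by
      calc (L ^ 2 / s) / (8 * π) ≤ 0.013581 / (8 * π) := div_le_div_of_nonneg_right hB2 (by positivity)
        _ ≤ 0.013581 / (8 * 3.141592) := div_le_div_of_nonneg_left (by norm_num) (by norm_num) (by linarith)
    norm_num at h1 h2 ⊢
    linarith
  -- `u = θ/x − 1`, `|u| ≤ δ`
  set q : ℝ := θ x / x with hq
  have hq1 : |q - 1| ≤ δ := by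
    have e : q - 1 = (θ x - x) / x := by rw [hq]; field_simp
    rw [e, abs_div, abs_of_pos hx0, div_le_iff₀ hx0]
    have e2 : δ * x = s * L ^ 2 / (8 * π) := by
      rw [hδ]; field_simp; nlinarith [hxs]
    rw [e2]
    exact abs_le.2 hSx
  have hqb := abs_le.1 hq1
  have hq0 : 0 < q := by linarith [hqb.1]
  -- `√q ≤ 1 + δ/2`, `log q ≤ δ`
  have hsq : Real.sqrt q ≤ 1 + δ / 2 := by
    calc Real.sqrt q ≤ Real.sqrt ((1 + δ / 2) ^ 2) := Real.sqrt_le_sqrt (by nlinarith [hqb.2])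
      _ = 1 + δ / 2 := Real.sqrt_sq (by positivity)
  have hlq : Real.log q ≤ δ := (Real.log_le_sub_one_of_pos hq0).trans (by linarith [hqb.2])
  have hfac : 1 + Real.log q / L ≤ 1 + δ / L := by
    have := div_le_div_of_nonneg_right hlq hLpos.le
    linarith
  have hfac0 : 0 ≤ 1 + Real.log q / L := by
    -- `log q ≥ 1 − 1/q ≥ −2δ ≥ −0.0011`, `L ≥ 20`
    have h := Real.one_sub_inv_le_log_of_pos hq0
    have hinv : q⁻¹ ≤ 1 / (1 - 0.00055) := by
      rw [inv_eq_one_div]; exact one_div_le_one_div_of_le (by norm_num) (by linarith [hqb.1])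
    have : (1 : ℝ) / (1 - 0.00055) ≤ 1.0006 := by norm_num
    have hlq' : -0.0006 ≤ Real.log q := by linarith
    have : -0.0006 / L ≤ Real.log q / L := div_le_div_of_nonneg_right hlq' hLpos.le
    have : -0.0006 / L ≥ -0.0006 / 20.7232658 := by
      rw [ge_iff_le, neg_div, neg_div, neg_le_neg_iff]
      exact div_le_div_of_nonneg_left (by norm_num) (by norm_num) hL0
    norm_num at *
    linarith
  rw [ratio_eq' hx3, ← hq]
  have hsq0 : 0 ≤ Real.sqrt q := Real.sqrt_nonneg _
  calc Real.sqrt q * (1 + Real.log q / L) ≤ (1 + δ / 2) * (1 + δ / L) :=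
        mul_le_mul hsq hfac hfac0 (by positivity)
    _ = 1 + (δ * (L / 2 + 1) + δ ^ 2 / 2) / L := by field_simp; ring
    _ ≤ 1 + 0.0069 / L := by
        have : δ * (L / 2 + 1) + δ ^ 2 / 2 ≤ 0.0069 := by nlinarith
        have := div_le_div_of_nonneg_right this hLpos.le
        linarith

end NicolasCUpper

open NicolasCUpper

/-! ### Prop. 3.1 (3.2) -/

/-- **Nicolas 2012, Prop. 3.1 (3.2)** over the two named facts as hypotheses (standard axioms): under
RH, if `10⁹ ≤ x` then `c(⌊x⌋#) ≤ e^γ(2+β) − 0.07/log x` (`⌊x⌋# = N_k` for `p_k ≤ x < p_{k+1}`; by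
(3.4) `c(N_k) = e^γ √θ log θ (1/f − 1)`, (2.17) and `ratio ≤ 1 + 0.0069/log x`:
`c(N_k) ≤ e^γ(1 + 0.0069/log x)(2 + β − 0.054/log x) ≤ e^γ(2+β) − e^γ(0.054 − 0.0069(2+β))/log x`).
[cite: Nicolas2012, Prop. 3.1 (3.2)] -/
theorem Nicolas2012_prop3_1_upper_of (hS : Schoenfeld1976_theta) (h18 : Nicolas2012_logf_lower_sharp)
    (hRH : RiemannHypothesis) {x : ℝ} (hx : (10 : ℝ) ^ 9 ≤ x) :
    nicolasC (primorial ⌊x⌋₊) ≤ nicolasCLimsup - 0.07 / Real.log x := by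
  have hx0 : 0 < x := lt_of_lt_of_le (by norm_num) hx
  have hx3 : (3 : ℝ) ≤ x := le_trans (by norm_num) hx
  obtain ⟨hlog9l, -⟩ := log_x0_bounds
  have hL0 : (20.7232658 : ℝ) ≤ Real.log x := hlog9l.trans (Real.log_le_log (by norm_num) hx)
  set L := Real.log x with hL
  set s := Real.sqrt x with hs
  have hLpos : 0 < L := by linarith
  have hspos : 0 < s := Real.sqrt_pos.2 hx0
  obtain ⟨hβ0, hβ⟩ := beta_bounds
  have hγ1 := exp_gamma_lt
  have hγ0 := exp_gamma_gt
  have hΛ := nicolasCLimsup_ge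
  -- the target is positive
  have hrhs : 0 < nicolasCLimsup - 0.07 / L := by
    have : 0.07 / L ≤ 0.07 / 20.7232658 := div_le_div_of_nonneg_left (by norm_num) (by norm_num) hL0
    norm_num at this; linarith
  rw [NicolasLimsup.nicolasC_primorial_floor_eq hx3]
  -- `A = √θ log θ = ratio · s L ≥ 0`
  have hθ1 := one_lt_theta hx3
  have hA : Real.sqrt (θ x) * Real.log (θ x) = NicolasLimsup.ratio x * (s * L) := by
    rw [NicolasLimsup.ratio, ← hs, ← hL]; field_simp
  have hA0 : 0 ≤ Real.sqrt (θ x) * Real.log (θ x) := by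
    have : 0 ≤ Real.log (θ x) := Real.log_nonneg hθ1.le
    positivity
  have hr := ratio_le_of hS hRH hx
  have hr0 : 0 ≤ NicolasLimsup.ratio x := by
    have h := hA0; rw [hA] at h
    exact nonneg_of_mul_nonneg_left h (by positivity) |> fun h' ↦ by
      by_contra hneg; push Not at hneg
      have : NicolasLimsup.ratio x * (s * L) < 0 := mul_neg_of_neg_of_pos hneg (by positivity)
      linarith
  rcases le_or_gt (1 / nicolasF x - 1) 0 with hneg | hpos
  · -- `1/f − 1 ≤ 0`: the left side is `≤ 0`
    have : rexp eulerMascheroniConstant * (Real.sqrt (θ x) * Real.log (θ x)) * (1 / nicolasF x - 1) ≤ 0 :=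
      mul_nonpos_iff.2 (Or.inl ⟨by positivity, hneg⟩)
    linarith
  · have hB := inv_nicolasF_sub_one_le_of h18 hRH hx
    rw [← hs, ← hL] at hB
    -- `e^γ A (1/f − 1) ≤ e^γ · ratio · (s L) · B = e^γ · ratio · ((2+β) − 0.054/L)`
    have hnum0 : 0 < (2 + nicolasBeta) - 0.054 / L := by
      have : 0.054 / L ≤ 0.054 / 20.7232658 := div_le_div_of_nonneg_left (by norm_num) (by norm_num) hL0
      norm_num at this; linarith
    have e1 : (s * L) * ((2 + nicolasBeta) / (s * L) - 0.054 / (s * L ^ 2)) = (2 + nicolasBeta) - 0.054 / L := by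
      field_simp
    have hSD : (s * L) * (1 / nicolasF x - 1) ≤ (2 + nicolasBeta) - 0.054 / L := by
      calc (s * L) * (1 / nicolasF x - 1)
          ≤ (s * L) * ((2 + nicolasBeta) / (s * L) - 0.054 / (s * L ^ 2)) :=
            mul_le_mul_of_nonneg_left hB (by positivity)
        _ = (2 + nicolasBeta) - 0.054 / L := e1
    have h1 : rexp eulerMascheroniConstant * (Real.sqrt (θ x) * Real.log (θ x)) * (1 / nicolasF x - 1) ≤
        rexp eulerMascheroniConstant * (NicolasLimsup.ratio x * ((2 + nicolasBeta) - 0.054 / L)) := by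
      have e2 : rexp eulerMascheroniConstant * (Real.sqrt (θ x) * Real.log (θ x)) * (1 / nicolasF x - 1) =
          rexp eulerMascheroniConstant * (NicolasLimsup.ratio x * ((s * L) * (1 / nicolasF x - 1))) := by
        rw [hA]; ring
      rw [e2]
      exact mul_le_mul_of_nonneg_left (mul_le_mul_of_nonneg_left hSD hr0) (Real.exp_pos _).le
    have h2 : NicolasLimsup.ratio x * ((2 + nicolasBeta) - 0.054 / L) ≤
        (1 + 0.0069 / L) * ((2 + nicolasBeta) - 0.054 / L) := mul_le_mul_of_nonneg_right hr hnum0.le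
    -- `(1 + 0.0069/L)(2 + β − 0.054/L) ≤ (2+β) − 0.03988/L`
    have h3 : (1 + 0.0069 / L) * ((2 + nicolasBeta) - 0.054 / L) ≤ (2 + nicolasBeta) - 0.03988 / L := by
      have e : (1 + 0.0069 / L) * ((2 + nicolasBeta) - 0.054 / L) =
          (2 + nicolasBeta) - (0.054 - 0.0069 * (2 + nicolasBeta)) / L - 0.0069 * 0.054 / L ^ 2 := by
        field_simp; ring
      rw [e]
      have h4 : 0.03988 / L ≤ (0.054 - 0.0069 * (2 + nicolasBeta)) / L :=
        div_le_div_of_nonneg_right (by nlinarith) hLpos.le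
      have h5 : 0 ≤ 0.0069 * 0.054 / L ^ 2 := by positivity
      linarith
    have h6 : rexp eulerMascheroniConstant * ((2 + nicolasBeta) - 0.03988 / L) ≤ nicolasCLimsup - 0.07 / L := by
      unfold nicolasCLimsup
      have : 0.07 / L ≤ rexp eulerMascheroniConstant * (0.03988 / L) := by
        rw [← mul_div_assoc]
        exact div_le_div_of_nonneg_right (by nlinarith) hLpos.le
      nlinarith
    calc rexp eulerMascheroniConstant * (Real.sqrt (θ x) * Real.log (θ x)) * (1 / nicolasF x - 1)
        ≤ rexp eulerMascheroniConstant * (NicolasLimsup.ratio x * ((2 + nicolasBeta) - 0.054 / L)) := h1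
      _ ≤ rexp eulerMascheroniConstant * ((1 + 0.0069 / L) * ((2 + nicolasBeta) - 0.054 / L)) :=
          mul_le_mul_of_nonneg_left h2 (Real.exp_pos _).le
      _ ≤ rexp eulerMascheroniConstant * ((2 + nicolasBeta) - 0.03988 / L) :=
          mul_le_mul_of_nonneg_left h3 (Real.exp_pos _).le
      _ ≤ nicolasCLimsup - 0.07 / L := h6

/-- **Nicolas 2012, Prop. 3.1 (3.2)**: under RH, for `x ≥ 10⁹`, `c(⌊x⌋#) ≤ e^γ(2+β) − 0.07/log x`
— with the tree's proofs of the two inputs (`Schoenfeld1976_theta_holds`,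
`Nicolas2012_logf_lower_sharp_holds`; computational closure through their certified zeta-zero
numerics). [cite: Nicolas2012, Prop. 3.1 (3.2)] -/
theorem Nicolas2012_prop3_1_upper (hRH : RiemannHypothesis) {x : ℝ} (hx : (10 : ℝ) ^ 9 ≤ x) :
    nicolasC (primorial ⌊x⌋₊) ≤ nicolasCLimsup - 0.07 / Real.log x :=
  Nicolas2012_prop3_1_upper_of Schoenfeld1976_theta_holds Nicolas2012_logf_lower_sharp_holds hRH hx

/-- **The analytic tail of (1.5)–(1.6)** ("for `k > k₀`, (3.2) implies `c(N_k) < e^γ(2+β)`", §4):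
under RH, `c(p#) < e^γ(2+β)` for every prime `p ≥ 10⁹`; over the two named facts (standard axioms).
[cite: Nicolas2012, §4 (proof of Thm. 1.1 (1.5)–(1.6), `k > k₀ = π(10⁹)`)] -/
theorem nicolasC_primorial_lt_nicolasCLimsup_of_ge_of (hS : Schoenfeld1976_theta)
    (h18 : Nicolas2012_logf_lower_sharp) (hRH : RiemannHypothesis) {p : ℕ} (hp : (10 : ℝ) ^ 9 ≤ p) :
    nicolasC (primorial p) < nicolasCLimsup := by
  have h := Nicolas2012_prop3_1_upper_of hS h18 hRH hp
  rw [Nat.floor_natCast] at h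
  have hL : 0 < Real.log p := Real.log_pos (lt_of_lt_of_le (by norm_num) hp)
  have : 0 < 0.07 / Real.log p := by positivity
  linarith

/-- **The analytic tail of (1.5)–(1.6)**, unconditionally in the inputs: under RH, `c(p#) < e^γ(2+β)`
for every prime `p ≥ 10⁹`. [cite: Nicolas2012, §4 (proof of Thm. 1.1 (1.5)–(1.6))] -/
theorem nicolasC_primorial_lt_nicolasCLimsup_of_ge (hRH : RiemannHypothesis) {p : ℕ}
    (hp : (10 : ℝ) ^ 9 ≤ p) : nicolasC (primorial p) < nicolasCLimsup :=
  nicolasC_primorial_lt_nicolasCLimsup_of_ge_of Schoenfeld1976_theta_holds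
    Nicolas2012_logf_lower_sharp_holds hRH hp

end Literature.NumberTheory.LFunctions

end
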